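import Mathlib
import Summits.Ventures.PercRepro2.OneEdge
import Summits.Ventures.PercRepro2.KPrimeReduction
import Summits.Ventures.PercRepro2.KPrimeBase
import Summits.Ventures.PercRepro2.KPrimeSure
import Summits.Ventures.PercRepro2.KPrimeEdgeSteps

/-!
# Resolving an edge from the root of `v` into the root of `a₁` keeps `(K′)` — unconditionally
(blind cell PercRepro2, mine-c g33; `conjectures/MINE-C.md` §42.2 (iv))

The `v`-EXPLORATION of `(K′)` (`MINE-C.md` §42) resolves the edges at the weight-`1` root of `v`.
Its two special edges are unconditional (`MINE-C.md` §42.0 / §42.2 (iv)):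

* `kprimeHolds_of_update_zero_va₁`: for an unresolved edge `e = {x, z}` with `x` in the root of
  `v` and `z` in the root of `a₁`, `(K′)` with `e` pinned closed gives `(K′)`.  Mechanism (exact):
  with `e` pinned open, `a₁ ↔ v` is sure, so the `N`-masses and the `(0,1)`-classes are null and the
  `U`-masses become `S`-masses; the events `S` and `Y ∩ S` are FLIP-INVARIANT at `e` (`C₂` avoids
  both ends of `e`), so their masses are the same in both worlds.  The cleared form then satisfies
  `form(p) = (1 − p e)² · form(p[e ↦ 0]) + p e (1 − p e) · P⁰(N) · (P¹(Y∩S)·P¹(X∩S) − P¹(Y∩X∩S)·P¹(S))`,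
  and the last bracket is `≥ 0` by BHK06 1.4 in the world `e` pinned open
  (`bhk_cross_cluster_avoid`: given `a₂ ↮ {a₁, v}`, `b ∈ C₁` and `y ∈ C₂` are negatively correlated).
* `kprimeHolds_of_update_zero_va₂`: for an unresolved edge `e = {x, z}` with `x` in the root of
  `v` and `z` in the root of `a₂`, pinned open `S` is null (`a₂ ↔ v` is sure), the `S`-masses scale
  by `1 − p e` and the `N`-masses are flip-invariant, so `form(p) = (1 − p e)² · form(p[e ↦ 0])` —
  the mirror of `kprimeHolds_of_update_zero_v` (`KPrimeEdgeSteps.lean`) with the roles of the two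
  roots exchanged.
-/

namespace Summit.Ventures.PercRepro2

namespace KPrime

variable {V : Type*} {E : Type*} [Fintype E] [DecidableEq E] [Fintype V] [DecidableEq V]
  {R : Type*} [Field R] [LinearOrder R] [IsStrictOrderedRing R]

section StepVA1

variable {ends : E → Sym2 V} {a₁ a₂ b v y : V} {p : E → R} {e : E}

omit [Fintype E] [Fintype V] [DecidableEq V] [IsStrictOrderedRing R] in
/-- Pinning an unresolved edge keeps the weight-`1` edges open on the sure set (the root of any
vertex is still surely connected); with `e = {x, z}` pinned open, `x` in the root of `v` and `z` in
the root of `a₁`, the vertices `a₁` and `v` are connected on the sure set. -/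
lemma conn_a₁_v_of_mem_sureSet_update_one {x z : V} (hends : ends e = s(x, z))
    (hx : x ∈ root p ends v) (hz : z ∈ root p ends a₁) (he : p e ≠ 1) {ω : Config E}
    (hω : ω ∈ sureSet (Function.update p e 1)) : Conn ends ω a₁ v := by
  have h1 : ω e = true := hω.1 e (by simp)
  have hle : oneConfig p ≤ ω := oneConfig_le_of_mem_sureSet_update he hω
  have hvx : Conn ends ω v x := conn_mono hle hx
  have haz : Conn ends ω a₁ z := conn_mono hle hz
  have hxz : Conn ends ω x z := conn_of_openAdj ⟨e, h1, hends⟩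
  exact conn_trans haz (conn_trans (conn_symm hxz) (conn_symm hvx))

omit [Fintype V] [DecidableEq V] [IsStrictOrderedRing R] in
/-- An event on which `a₁ ↮ v` is null once an edge from the root of `v` into the root of `a₁` is
pinned open. -/
lemma prob_update_one_eq_zero_of_subset_Uc {x z : V} (hends : ends e = s(x, z))
    (hx : x ∈ root p ends v) (hz : z ∈ root p ends a₁) (he : p e ≠ 1) {A : Set (Config E)}
    (hA : A ⊆ (connEvent ends a₁ v)ᶜ) : prob (Function.update p e 1) A = 0 := by
  apply prob_eq_zero_of_inter_sureSet_eq_empty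
  ext ω
  simp only [Set.mem_inter_iff, Set.mem_empty_iff_false, iff_false, not_and]
  intro hωA hω
  exact (hA hωA) (conn_a₁_v_of_mem_sureSet_update_one hends hx hz he hω)

omit [Fintype V] [DecidableEq V] [IsStrictOrderedRing R] in
/-- An event on which `a₁ ↮ v` has mass `(1 − p e)` times its mass with the edge pinned closed. -/
lemma prob_eq_scale_of_subset_Uc {x z : V} (hends : ends e = s(x, z))
    (hx : x ∈ root p ends v) (hz : z ∈ root p ends a₁) (he : p e ≠ 1) {A : Set (Config E)}
    (hA : A ⊆ (connEvent ends a₁ v)ᶜ) :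
    prob p A = (1 - p e) * prob (Function.update p e 0) A := by
  rw [prob_eq_pin p A e, prob_update_one_eq_zero_of_subset_Uc hends hx hz he hA, mul_zero,
    zero_add]

omit [Fintype E] [DecidableEq E] [Fintype V] [LinearOrder R] [IsStrictOrderedRing R] in
/-- `S` is a decreasing event. -/
lemma S_anti {ω ω' : Config E} (h : ω ≤ ω') (hω' : ω' ∈ S ends a₁ a₂ v) : ω ∈ S ends a₁ a₂ v := by
  rw [mem_S] at hω' ⊢
  exact ⟨fun hc => hω'.1 (conn_mono h hc), fun hc => hω'.2 (conn_mono h hc)⟩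

omit [Fintype E] [Fintype V] [DecidableEq V] [IsStrictOrderedRing R] in
/-- Pinning `e` closed keeps the weight-`1` edges of `p` open. -/
lemma oneConfig_le_update_false (he : p e ≠ 1) {ω : Config E} (hle : oneConfig p ≤ ω) :
    oneConfig p ≤ Function.update ω e false := by
  intro f
  by_cases hf : f = e
  · subst hf; simp [oneConfig, he]
  · simp only [Function.update_of_ne hf]; exact hle f

omit [Fintype E] [Fintype V] [IsStrictOrderedRing R] in
/-- With `e = {x, z}`, `x` in the root of `v`, `z` in the root of `a₁`, the weight-`1` edges open and
`e` pinned closed: opening `e` keeps `S` (the only new routes from `a₂` go through `x ↔ v` or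
through `z ↔ a₁`). -/
lemma update_true_mem_S {x z : V} (hends : ends e = s(x, z)) (hx : x ∈ root p ends v)
    (hz : z ∈ root p ends a₁) (he : p e ≠ 1) {ω : Config E} (hle : oneConfig p ≤ ω)
    (hω : Function.update ω e false ∈ S ends a₁ a₂ v) :
    Function.update ω e true ∈ S ends a₁ a₂ v := by
  set ω' := Function.update ω e false with hω'
  have hle' : oneConfig p ≤ ω' := oneConfig_le_update_false he hle
  have hvx : Conn ends ω' v x := conn_mono hle' hx
  have haz : Conn ends ω' a₁ z := conn_mono hle' hz
  have heq : Function.update ω e true = Function.update ω' e true := by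
    simp [hω', Function.update_idem]
  rw [heq, mem_S, OneEdge.conn_update_true_iff hends, OneEdge.conn_update_true_iff hends]
  rw [mem_S] at hω
  refine ⟨?_, ?_⟩
  · rintro (h | ⟨h1, _⟩ | ⟨h1, _⟩)
    · exact hω.1 h
    · exact hω.2 (conn_trans h1 (conn_symm hvx))
    · exact hω.1 (conn_trans h1 (conn_symm haz))
  · rintro (h | ⟨h1, _⟩ | ⟨h1, _⟩)
    · exact hω.2 h
    · exact hω.2 (conn_trans h1 (conn_symm hvx))
    · exact hω.1 (conn_trans h1 (conn_symm haz))

omit [Fintype E] [Fintype V] [IsStrictOrderedRing R] in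
/-- Flip invariance of `S` at an edge from the root of `v` into the root of `a₁`. -/
lemma S_flip_invariant_va₁ {x z : V} (hends : ends e = s(x, z)) (hx : x ∈ root p ends v)
    (hz : z ∈ root p ends a₁) (he : p e ≠ 1) (ω : Config E) (hle : oneConfig p ≤ ω) :
    (Function.update ω e true ∈ S ends a₁ a₂ v ↔ Function.update ω e false ∈ S ends a₁ a₂ v) :=
  ⟨fun h => S_anti (update_false_le_update_true' ω e) h, update_true_mem_S hends hx hz he hle⟩

omit [Fintype E] [Fintype V] [IsStrictOrderedRing R] in
/-- Flip invariance of `Y ∩ S` at an edge from the root of `v` into the root of `a₁`. -/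
lemma YS_flip_invariant_va₁ {x z : V} (hends : ends e = s(x, z)) (hx : x ∈ root p ends v)
    (hz : z ∈ root p ends a₁) (he : p e ≠ 1) (ω : Config E) (hle : oneConfig p ≤ ω) :
    (Function.update ω e true ∈ connEvent ends a₂ y ∩ S ends a₁ a₂ v ↔
      Function.update ω e false ∈ connEvent ends a₂ y ∩ S ends a₁ a₂ v) := by
  set ω' := Function.update ω e false with hω'
  have hle' : oneConfig p ≤ ω' := oneConfig_le_update_false he hle
  have hvx : Conn ends ω' v x := conn_mono hle' hx
  have haz : Conn ends ω' a₁ z := conn_mono hle' hz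
  have heq : Function.update ω e true = Function.update ω' e true := by
    simp [hω', Function.update_idem]
  have hS := S_flip_invariant_va₁ (a₂ := a₂) hends hx hz he ω hle
  rw [heq] at hS ⊢
  simp only [Set.mem_inter_iff, mem_connEvent]
  constructor
  · rintro ⟨hy, hS'⟩
    have hS'' : ω' ∈ S ends a₁ a₂ v := hS.1 hS'
    refine ⟨?_, hS''⟩
    rw [OneEdge.conn_update_true_iff hends] at hy
    rcases hy with h | ⟨h1, _⟩ | ⟨h1, _⟩
    · exact h
    · exact absurd (conn_trans h1 (conn_symm hvx)) (mem_S.1 hS'').2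
    · exact absurd (conn_trans h1 (conn_symm haz)) (mem_S.1 hS'').1
  · rintro ⟨hy, hS'⟩
    exact ⟨conn_mono (OneEdge.le_update_true ω' e) hy, hS.2 hS'⟩

omit [Fintype V] [DecidableEq V] [IsStrictOrderedRing R] in
/-- On the sure set of `p[e ↦ 1]` the event `{a₁ ↔ v}` is sure, so an event `U ∩ A` has the mass
of `A`. -/
lemma prob_update_one_inter_U {x z : V} (hends : ends e = s(x, z)) (hx : x ∈ root p ends v)
    (hz : z ∈ root p ends a₁) (he : p e ≠ 1) (A : Set (Config E)) :
    prob (Function.update p e 1) (connEvent ends a₁ v ∩ A) = prob (Function.update p e 1) A := by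
  apply prob_congr_sure
  ext ω
  simp only [Set.mem_inter_iff, mem_connEvent]
  constructor
  · rintro ⟨⟨_, hA⟩, hω⟩; exact ⟨hA, hω⟩
  · rintro ⟨hA, hω⟩
    exact ⟨⟨conn_a₁_v_of_mem_sureSet_update_one hends hx hz he hω, hA⟩, hω⟩

/-- **Resolving an edge from the root of `v` into the root of `a₁`**: `(K′)` with the edge pinned
closed gives `(K′)` — `form(p) = (1 − p e)² · form(p[e ↦ 0]) + p e (1 − p e) · P⁰(N) · (BHK slack)`. -/
theorem kprimeHolds_of_update_zero_va₁ (hp : IsProbVec p) {x z : V} (hends : ends e = s(x, z))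
    (hx : x ∈ root p ends v) (hz : z ∈ root p ends a₁) (he : p e ≠ 1)
    (h0 : KPrimeHolds ends a₁ a₂ b v y (Function.update p e 0)) :
    KPrimeHolds ends a₁ a₂ b v y p := by
  -- the masses that vanish with `e` pinned open: `N`, `X ∩ N`, `(0,1)`, `(0,1)ᵉ`
  have sc : ∀ A : Set (Config E), A ⊆ (connEvent ends a₁ v)ᶜ →
      prob p A = (1 - p e) * prob (Function.update p e 0) A :=
    fun A hA => prob_eq_scale_of_subset_Uc hends hx hz he hA
  have hN : N ends a₁ a₂ v ⊆ (connEvent ends a₁ v)ᶜ := fun ω hω => (mem_N.1 hω).2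
  have hXN : connEvent ends a₁ b ∩ N ends a₁ a₂ v ⊆ (connEvent ends a₁ v)ᶜ :=
    fun ω hω => hN hω.2
  have h01 : cls01 ends a₁ a₂ v y ⊆ (connEvent ends a₁ v)ᶜ := fun ω hω => hω.1.1
  have h01e : cls01e ends a₁ a₂ b v y ⊆ (connEvent ends a₁ v)ᶜ := fun ω hω => hω.1.1.1
  -- flip invariance of `S` and `Y ∩ S`
  have hS1 : prob (Function.update p e 1) (S ends a₁ a₂ v) =
      prob (Function.update p e 0) (S ends a₁ a₂ v) :=
    prob_update_one_eq_update_zero he (S_flip_invariant_va₁ hends hx hz he)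
  have hYS1 : prob (Function.update p e 1) (connEvent ends a₂ y ∩ S ends a₁ a₂ v) =
      prob (Function.update p e 0) (connEvent ends a₂ y ∩ S ends a₁ a₂ v) :=
    prob_update_one_eq_update_zero he (YS_flip_invariant_va₁ hends hx hz he)
  -- the `U`-masses with `e` pinned open are `S`-masses
  have hU : ∀ A : Set (Config E), prob (Function.update p e 1) (connEvent ends a₁ v ∩ A) =
      prob (Function.update p e 1) A := fun A => prob_update_one_inter_U hends hx hz he A
  have e1 : connEvent ends a₁ v ∩ connEvent ends a₁ b ∩ Ω ends a₁ a₂ =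
      connEvent ends a₁ v ∩ (connEvent ends a₁ b ∩ S ends a₁ a₂ v) := by
    rw [Set.inter_assoc, Set.inter_comm (connEvent ends a₁ b), ← Set.inter_assoc, U_inter_Ω_eq,
      Set.inter_assoc, Set.inter_comm (S ends a₁ a₂ v)]
  have e2 : connEvent ends a₁ v ∩ connEvent ends a₂ y ∩ connEvent ends a₁ b ∩ Ω ends a₁ a₂ =
      connEvent ends a₁ v ∩ (connEvent ends a₂ y ∩ connEvent ends a₁ b ∩ S ends a₁ a₂ v) := by
    ext ω
    simp only [Set.mem_inter_iff, mem_connEvent, mem_Ω, mem_S]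
    constructor
    · rintro ⟨⟨⟨hu, hy⟩, hb⟩, hΩ⟩
      exact ⟨hu, ⟨hy, hb⟩, fun h => hΩ (conn_symm h), fun h => hΩ (conn_trans hu (conn_symm h))⟩
    · rintro ⟨hu, ⟨hy, hb⟩, h1, _⟩
      exact ⟨⟨⟨hu, hy⟩, hb⟩, fun h => h1 (conn_symm h)⟩
  have e3 : connEvent ends a₁ v ∩ connEvent ends a₂ y ∩ Ω ends a₁ a₂ =
      connEvent ends a₁ v ∩ (connEvent ends a₂ y ∩ S ends a₁ a₂ v) := by
    ext ω
    simp only [Set.mem_inter_iff, mem_connEvent, mem_Ω, mem_S]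
    constructor
    · rintro ⟨⟨hu, hy⟩, hΩ⟩
      exact ⟨hu, hy, fun h => hΩ (conn_symm h), fun h => hΩ (conn_trans hu (conn_symm h))⟩
    · rintro ⟨hu, hy, h1, _⟩
      exact ⟨⟨hu, hy⟩, fun h => h1 (conn_symm h)⟩
  have e4 : connEvent ends a₁ v ∩ Ω ends a₁ a₂ = connEvent ends a₁ v ∩ S ends a₁ a₂ v :=
    U_inter_Ω_eq
  -- BHK06 1.4 with `e` pinned open
  have hp1 : IsProbVec (Function.update p e 1) := hp.update e zero_le_one le_rfl
  have ha₁ : a₁ ∈ ({a₁, v} : Finset V) := by simp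
  have hB := bhk_cross_cluster_avoid (Function.update p e 1) hp1 ends a₂ a₁ (X := {a₁, v}) ha₁
    (isUpperSet_mem y) (isUpperSet_mem b)
  rw [clusterInEvent_mem_eq, clusterInEvent_mem_eq] at hB
  change prob (Function.update p e 1) (connEvent ends a₂ y ∩ connEvent ends a₁ b ∩ S ends a₁ a₂ v) *
      prob (Function.update p e 1) (S ends a₁ a₂ v) ≤
    prob (Function.update p e 1) (connEvent ends a₂ y ∩ S ends a₁ a₂ v) *
      prob (Function.update p e 1) (connEvent ends a₁ b ∩ S ends a₁ a₂ v) at hB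
  -- the `U`-masses with `e` pinned open, as `S`-masses
  have hA1 : prob (Function.update p e 1) (connEvent ends a₁ v ∩ connEvent ends a₁ b ∩ Ω ends a₁ a₂) =
      prob (Function.update p e 1) (connEvent ends a₁ b ∩ S ends a₁ a₂ v) := by rw [e1, hU]
  have hH1 : prob (Function.update p e 1) (connEvent ends a₁ v ∩ Ω ends a₁ a₂) =
      prob (Function.update p e 1) (S ends a₁ a₂ v) := by rw [e4, hU]
  have hC1 : prob (Function.update p e 1)
      (connEvent ends a₁ v ∩ connEvent ends a₂ y ∩ connEvent ends a₁ b ∩ Ω ends a₁ a₂) =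
      prob (Function.update p e 1) (connEvent ends a₂ y ∩ connEvent ends a₁ b ∩ S ends a₁ a₂ v) := by
    rw [e2, hU]
  have hD1 : prob (Function.update p e 1) (connEvent ends a₁ v ∩ connEvent ends a₂ y ∩ Ω ends a₁ a₂) =
      prob (Function.update p e 1) (connEvent ends a₂ y ∩ S ends a₁ a₂ v) := by rw [e3, hU]
  -- expand the form
  unfold KPrimeHolds kprimeForm at h0 ⊢
  rw [sc _ hN, sc _ hXN, sc _ h01, sc _ h01e]
  rw [prob_eq_pin p (connEvent ends a₁ v ∩ connEvent ends a₁ b ∩ Ω ends a₁ a₂) e,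
    prob_eq_pin p (connEvent ends a₁ v ∩ Ω ends a₁ a₂) e,
    prob_eq_pin p (connEvent ends a₂ y ∩ S ends a₁ a₂ v) e,
    prob_eq_pin p (S ends a₁ a₂ v) e,
    prob_eq_pin p (connEvent ends a₁ v ∩ connEvent ends a₂ y ∩ connEvent ends a₁ b ∩ Ω ends a₁ a₂) e,
    prob_eq_pin p (connEvent ends a₁ v ∩ connEvent ends a₂ y ∩ Ω ends a₁ a₂) e]
  rw [hA1, hH1, hC1, hD1, hS1, hYS1]
  rw [hS1, hYS1] at hB
  have h1t : 0 ≤ 1 - p e := sub_nonneg.2 (hp.le_one e)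
  have ht : 0 ≤ p e := hp.nonneg e
  have hD : 0 ≤ prob (Function.update p e 0) (N ends a₁ a₂ v) :=
    prob_nonneg (hp.update e le_rfl zero_le_one) _
  have h2 : 0 ≤ (1 - p e) ^ 2 := pow_nonneg h1t 2
  nlinarith [mul_nonneg h2 h0, mul_nonneg (mul_nonneg (mul_nonneg ht h1t) hD) (sub_nonneg.2 hB)]

end StepVA1

/-! ## Resolving an edge from the root of `v` into the root of `a₂`: `S` is killed, the `N`-masses are unchanged -/

section StepVA2

variable {ends : E → Sym2 V} {a₁ a₂ b v y : V} {p : E → R} {e : E}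

omit [Fintype E] [Fintype V] [DecidableEq V] [IsStrictOrderedRing R] in
/-- With `e = {x, z}` pinned open, `x` in the root of `v` and `z` in the root of `a₂`, the vertices
`a₂` and `v` are connected on the sure set. -/
lemma conn_a₂_v_of_mem_sureSet_update_one {x z : V} (hends : ends e = s(x, z))
    (hx : x ∈ root p ends v) (hz : z ∈ root p ends a₂) (he : p e ≠ 1) {ω : Config E}
    (hω : ω ∈ sureSet (Function.update p e 1)) : Conn ends ω a₂ v := by
  have h1 : ω e = true := hω.1 e (by simp)
  have hle : oneConfig p ≤ ω := oneConfig_le_of_mem_sureSet_update he hω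
  have hvx : Conn ends ω v x := conn_mono hle hx
  have haz : Conn ends ω a₂ z := conn_mono hle hz
  have hxz : Conn ends ω x z := conn_of_openAdj ⟨e, h1, hends⟩
  exact conn_trans haz (conn_trans (conn_symm hxz) (conn_symm hvx))

omit [Fintype V] [IsStrictOrderedRing R] in
/-- An event inside `S` is null once an edge from the root of `v` into the root of `a₂` is pinned
open. -/
lemma prob_update_one_eq_zero_of_subset_S_va₂ {x z : V} (hends : ends e = s(x, z))
    (hx : x ∈ root p ends v) (hz : z ∈ root p ends a₂) (he : p e ≠ 1) {A : Set (Config E)}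
    (hA : A ⊆ S ends a₁ a₂ v) : prob (Function.update p e 1) A = 0 := by
  apply prob_eq_zero_of_inter_sureSet_eq_empty
  ext ω
  simp only [Set.mem_inter_iff, Set.mem_empty_iff_false, iff_false, not_and]
  intro hωA hω
  exact (mem_S.1 (hA hωA)).2 (conn_a₂_v_of_mem_sureSet_update_one hends hx hz he hω)

omit [Fintype V] [IsStrictOrderedRing R] in
/-- An event inside `S` has mass `(1 − p e)` times its mass with the edge pinned closed. -/
lemma prob_eq_scale_of_subset_S_va₂ {x z : V} (hends : ends e = s(x, z))
    (hx : x ∈ root p ends v) (hz : z ∈ root p ends a₂) (he : p e ≠ 1) {A : Set (Config E)}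
    (hA : A ⊆ S ends a₁ a₂ v) : prob p A = (1 - p e) * prob (Function.update p e 0) A := by
  rw [prob_eq_pin p A e, prob_update_one_eq_zero_of_subset_S_va₂ hends hx hz he hA, mul_zero,
    zero_add]

omit [Fintype E] [Fintype V] [IsStrictOrderedRing R] in
/-- With `e = {x, z}`, `x` in the root of `v`, `z` in the root of `a₂`, the weight-`1` edges open
and `e` pinned closed: opening `e` keeps `N` (the only new routes from `a₁` go through `x ↔ v` or
through `z ↔ a₂`). -/
lemma update_true_mem_N_va₂ {x z : V} (hends : ends e = s(x, z)) (hx : x ∈ root p ends v)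
    (hz : z ∈ root p ends a₂) (he : p e ≠ 1) {ω : Config E} (hle : oneConfig p ≤ ω)
    (hω : Function.update ω e false ∈ N ends a₁ a₂ v) :
    Function.update ω e true ∈ N ends a₁ a₂ v := by
  set ω' := Function.update ω e false with hω'
  have hle' : oneConfig p ≤ ω' := oneConfig_le_update_false he hle
  have hvx : Conn ends ω' v x := conn_mono hle' hx
  have haz : Conn ends ω' a₂ z := conn_mono hle' hz
  have heq : Function.update ω e true = Function.update ω' e true := by
    simp [hω', Function.update_idem]
  rw [heq, mem_N, OneEdge.conn_update_true_iff hends, OneEdge.conn_update_true_iff hends]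
  rw [mem_N] at hω
  refine ⟨?_, ?_⟩
  · rintro (h | ⟨h1, _⟩ | ⟨h1, _⟩)
    · exact hω.1 h
    · exact hω.2 (conn_trans h1 (conn_symm hvx))
    · exact hω.1 (conn_trans h1 (conn_symm haz))
  · rintro (h | ⟨h1, _⟩ | ⟨h1, _⟩)
    · exact hω.2 h
    · exact hω.2 (conn_trans h1 (conn_symm hvx))
    · exact hω.1 (conn_trans h1 (conn_symm haz))

omit [Fintype E] [Fintype V] [IsStrictOrderedRing R] in
/-- Flip invariance of `N` at an edge from the root of `v` into the root of `a₂`. -/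
lemma N_flip_invariant_va₂ {x z : V} (hends : ends e = s(x, z)) (hx : x ∈ root p ends v)
    (hz : z ∈ root p ends a₂) (he : p e ≠ 1) (ω : Config E) (hle : oneConfig p ≤ ω) :
    (Function.update ω e true ∈ N ends a₁ a₂ v ↔ Function.update ω e false ∈ N ends a₁ a₂ v) :=
  ⟨fun h => N_anti (update_false_le_update_true' ω e) h, update_true_mem_N_va₂ hends hx hz he hle⟩

omit [Fintype E] [Fintype V] [IsStrictOrderedRing R] in
/-- Flip invariance of `X ∩ N` at an edge from the root of `v` into the root of `a₂`. -/
lemma XN_flip_invariant_va₂ {x z : V} (hends : ends e = s(x, z)) (hx : x ∈ root p ends v)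
    (hz : z ∈ root p ends a₂) (he : p e ≠ 1) (ω : Config E) (hle : oneConfig p ≤ ω) :
    (Function.update ω e true ∈ connEvent ends a₁ b ∩ N ends a₁ a₂ v ↔
      Function.update ω e false ∈ connEvent ends a₁ b ∩ N ends a₁ a₂ v) := by
  set ω' := Function.update ω e false with hω'
  have hle' : oneConfig p ≤ ω' := oneConfig_le_update_false he hle
  have hvx : Conn ends ω' v x := conn_mono hle' hx
  have haz : Conn ends ω' a₂ z := conn_mono hle' hz
  have heq : Function.update ω e true = Function.update ω' e true := by
    simp [hω', Function.update_idem]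
  have hN := N_flip_invariant_va₂ (a₁ := a₁) hends hx hz he ω hle
  rw [heq] at hN ⊢
  simp only [Set.mem_inter_iff, mem_connEvent]
  constructor
  · rintro ⟨hb, hN'⟩
    have hN'' : ω' ∈ N ends a₁ a₂ v := hN.1 hN'
    refine ⟨?_, hN''⟩
    rw [OneEdge.conn_update_true_iff hends] at hb
    rcases hb with h | ⟨h1, _⟩ | ⟨h1, _⟩
    · exact h
    · exact absurd (conn_trans h1 (conn_symm hvx)) (mem_N.1 hN'').2
    · exact absurd (conn_trans h1 (conn_symm haz)) (mem_N.1 hN'').1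
  · rintro ⟨hb, hN'⟩
    exact ⟨conn_mono (OneEdge.le_update_true ω' e) hb, hN.2 hN'⟩

omit [Fintype V] in
/-- **Resolving an edge from the root of `v` into the root of `a₂`**: `(K′)` with the edge pinned
closed gives `(K′)` (pinned open, `S` is null; the `S`-masses scale by `1 − p e`, the `N`-masses are
unchanged by flip invariance; the form scales by `(1 − p e)²`). -/
theorem kprimeHolds_of_update_zero_va₂ (hp : IsProbVec p) {x z : V} (hends : ends e = s(x, z))
    (hx : x ∈ root p ends v) (hz : z ∈ root p ends a₂) (he : p e ≠ 1)
    (h0 : KPrimeHolds ends a₁ a₂ b v y (Function.update p e 0)) :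
    KPrimeHolds ends a₁ a₂ b v y p := by
  have sc : ∀ A : Set (Config E), A ⊆ S ends a₁ a₂ v →
      prob p A = (1 - p e) * prob (Function.update p e 0) A :=
    fun A hA => prob_eq_scale_of_subset_S_va₂ hends hx hz he hA
  have hUΩ : connEvent ends a₁ v ∩ Ω ends a₁ a₂ ⊆ S ends a₁ a₂ v := by
    rw [U_inter_Ω_eq]; exact Set.inter_subset_right
  have hN : prob p (N ends a₁ a₂ v) = prob (Function.update p e 0) (N ends a₁ a₂ v) :=
    prob_eq_of_flip_invariant he (N_flip_invariant_va₂ hends hx hz he)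
  have hXN : prob p (connEvent ends a₁ b ∩ N ends a₁ a₂ v) =
      prob (Function.update p e 0) (connEvent ends a₁ b ∩ N ends a₁ a₂ v) :=
    prob_eq_of_flip_invariant he (XN_flip_invariant_va₂ hends hx hz he)
  unfold KPrimeHolds kprimeForm at h0 ⊢
  have s1 : connEvent ends a₁ v ∩ connEvent ends a₁ b ∩ Ω ends a₁ a₂ ⊆ S ends a₁ a₂ v := by
    intro ω hω; exact hUΩ ⟨hω.1.1, hω.2⟩
  have s7 : connEvent ends a₁ v ∩ connEvent ends a₂ y ∩ connEvent ends a₁ b ∩ Ω ends a₁ a₂ ⊆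
      S ends a₁ a₂ v := by
    intro ω hω; exact hUΩ ⟨hω.1.1.1, hω.2⟩
  have s8 : connEvent ends a₁ v ∩ connEvent ends a₂ y ∩ Ω ends a₁ a₂ ⊆ S ends a₁ a₂ v := by
    intro ω hω; exact hUΩ ⟨hω.1.1, hω.2⟩
  rw [sc _ s1, sc _ hUΩ, sc _ Set.inter_subset_right, sc _ (subset_refl _), sc _ cls01e_subset_S,
    sc _ cls01_subset_S, sc _ s7, sc _ s8, hN, hXN]
  have h1t : 0 ≤ 1 - p e := sub_nonneg.2 (hp.le_one e)
  have h2 : 0 ≤ (1 - p e) ^ 2 := pow_nonneg h1t 2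
  nlinarith [mul_nonneg h2 h0]

end StepVA2

end KPrime

end Summit.Ventures.PercRepro2
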